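import Mathlib

/-!
# SoloBlind — resolvent continuation from a certified grid point (SCALING remedy R8)

Certified inverse bounds are produced POINTWISE in the spectral parameter `x` and continued to a
disc around each grid point.  In a complete normed ring with `‖1‖ = 1`: if `u` is a unit with
`‖u⁻¹‖ ≤ Q` and `‖e‖ ≤ δ` with `δ Q < 1`, then `u + e` is a unit,
`‖(u + e)⁻¹‖ ≤ Q / (1 - δ Q)` and `‖(u + e)⁻¹ - u⁻¹‖ ≤ Q Q δ / (1 - δ Q)`.
For the affine families of the chain operators, `a x = a₀ - (x - x₀) • s` (every diagonal entry
`β_k(x)` depends on `x` through the same coefficient), this gives the continuation disc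
`‖x - x₀‖ ≤ ρ`, `ρ ‖s‖ Q < 1` with the same two bounds for `δ = ρ ‖s‖`, and a grid version:
finitely many certified points whose continuation discs cover a set certify the whole set.
-/

namespace Summit.AnomalousDissipation.AnomalousDissipation.Theorems

section Ring

variable {A : Type*} [NormedRing A] [NormOneClass A] [CompleteSpace A]

/-- Geometric-series bound for `(1 - t)⁻¹` in a complete normed ring with `‖1‖ = 1`. -/
theorem norm_oneSub_inv_le_ring {t : A} (ht : ‖t‖ < 1) :
    ‖(↑(Units.oneSub t ht)⁻¹ : A)‖ ≤ (1 - ‖t‖)⁻¹ := by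
  have h1 : (↑(Units.oneSub t ht)⁻¹ : A) = ∑' n : ℕ, t ^ n := rfl
  rw [h1]
  have h2 := tsum_geometric_le_of_norm_lt_one t ht
  have h3 : ‖(1 : A)‖ = 1 := norm_one
  linarith

/-- **Perturbation of a certified unit.**  `‖u⁻¹‖ ≤ Q`, `‖e‖ ≤ δ`, `δ Q < 1` ⇒ `u + e` is a unit with
`‖(u+e)⁻¹‖ ≤ Q / (1 - δ Q)` and `‖(u+e)⁻¹ - u⁻¹‖ ≤ Q Q δ / (1 - δ Q)`. -/
theorem unit_add_norm_inv_le (u : Aˣ) {e : A} {Q δ : ℝ} (hQ : ‖(↑u⁻¹ : A)‖ ≤ Q) (he : ‖e‖ ≤ δ)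
    (hδ : δ * Q < 1) :
    ∃ v : Aˣ, (v : A) = u + e ∧ ‖(↑v⁻¹ : A)‖ ≤ Q / (1 - δ * Q) ∧
      ‖(↑v⁻¹ : A) - ↑u⁻¹‖ ≤ Q * Q * δ / (1 - δ * Q) := by
  have hQ0 : 0 ≤ Q := (norm_nonneg _).trans hQ
  have hδ0 : 0 ≤ δ := (norm_nonneg _).trans he
  set t : A := -((↑u⁻¹ : A) * e) with ht_def
  have htn : ‖t‖ ≤ δ * Q := by
    rw [ht_def, norm_neg]
    calc ‖(↑u⁻¹ : A) * e‖ ≤ ‖(↑u⁻¹ : A)‖ * ‖e‖ := norm_mul_le _ _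
      _ ≤ Q * δ := mul_le_mul hQ he (norm_nonneg _) hQ0
      _ = δ * Q := mul_comm _ _
  have ht1 : ‖t‖ < 1 := lt_of_le_of_lt htn hδ
  set w : Aˣ := Units.oneSub t ht1 with hw_def
  have hwval : (w : A) = 1 - t := rfl
  refine ⟨u * w, ?_, ?_, ?_⟩
  · rw [Units.val_mul, hwval, ht_def, sub_neg_eq_add, mul_add, mul_one, ← mul_assoc, Units.mul_inv, one_mul]
  · have hinv : (↑(u * w)⁻¹ : A) = (↑w⁻¹ : A) * ↑u⁻¹ := by
      rw [mul_inv_rev, Units.val_mul]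
    have hwn : ‖(↑w⁻¹ : A)‖ ≤ (1 - δ * Q)⁻¹ := by
      have h := norm_oneSub_inv_le_ring ht1
      have hpos : 0 < 1 - δ * Q := by linarith
      have hpos' : 0 < 1 - ‖t‖ := by linarith
      calc ‖(↑w⁻¹ : A)‖ ≤ (1 - ‖t‖)⁻¹ := h
        _ ≤ (1 - δ * Q)⁻¹ := by
          apply inv_anti₀ hpos; linarith
    rw [hinv]
    calc ‖(↑w⁻¹ : A) * ↑u⁻¹‖ ≤ ‖(↑w⁻¹ : A)‖ * ‖(↑u⁻¹ : A)‖ := norm_mul_le _ _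
      _ ≤ (1 - δ * Q)⁻¹ * Q := mul_le_mul hwn hQ (norm_nonneg _) (by positivity)
      _ = Q / (1 - δ * Q) := by rw [div_eq_mul_inv, mul_comm]
  · have hinv : (↑(u * w)⁻¹ : A) = (↑w⁻¹ : A) * ↑u⁻¹ := by
      rw [mul_inv_rev, Units.val_mul]
    -- (1 - t)⁻¹ - 1 = (1 - t)⁻¹ t
    have hid : (↑w⁻¹ : A) - 1 = (↑w⁻¹ : A) * t := by
      have h1 : (↑w⁻¹ : A) * (w : A) = 1 := Units.inv_mul w
      rw [hwval, mul_sub, mul_one] at h1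
      -- h1 : ↑w⁻¹ - ↑w⁻¹ * t = 1
      calc (↑w⁻¹ : A) - 1 = (↑w⁻¹ : A) - ((↑w⁻¹ : A) - (↑w⁻¹ : A) * t) := by rw [h1]
        _ = (↑w⁻¹ : A) * t := by abel
    have hdiff : (↑(u * w)⁻¹ : A) - ↑u⁻¹ = ((↑w⁻¹ : A) * t) * ↑u⁻¹ := by
      rw [hinv, ← hid, sub_mul, one_mul]
    have hpos : 0 < 1 - δ * Q := by linarith
    have hwn : ‖(↑w⁻¹ : A)‖ ≤ (1 - δ * Q)⁻¹ := by
      have h := norm_oneSub_inv_le_ring ht1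
      have hpos' : 0 < 1 - ‖t‖ := by linarith
      calc ‖(↑w⁻¹ : A)‖ ≤ (1 - ‖t‖)⁻¹ := h
        _ ≤ (1 - δ * Q)⁻¹ := by
          apply inv_anti₀ hpos; linarith
    rw [hdiff]
    calc ‖((↑w⁻¹ : A) * t) * ↑u⁻¹‖ ≤ ‖(↑w⁻¹ : A) * t‖ * ‖(↑u⁻¹ : A)‖ := norm_mul_le _ _
      _ ≤ (‖(↑w⁻¹ : A)‖ * ‖t‖) * ‖(↑u⁻¹ : A)‖ :=
          mul_le_mul_of_nonneg_right (norm_mul_le _ _) (norm_nonneg _)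
      _ ≤ ((1 - δ * Q)⁻¹ * (δ * Q)) * Q := by
          apply mul_le_mul _ hQ (norm_nonneg _) (by positivity)
          exact mul_le_mul hwn htn (norm_nonneg _) (by positivity)
      _ = Q * Q * δ / (1 - δ * Q) := by
          rw [div_eq_mul_inv]; ring

/-- The same with the conclusion phrased via `Ring.inverse` of the element `u + e` (no unit witness). -/
theorem isUnit_add_norm_inverse_le (u : Aˣ) {e : A} {Q δ : ℝ} (hQ : ‖(↑u⁻¹ : A)‖ ≤ Q)
    (he : ‖e‖ ≤ δ) (hδ : δ * Q < 1) :
    IsUnit ((u : A) + e) ∧ ‖Ring.inverse ((u : A) + e)‖ ≤ Q / (1 - δ * Q) ∧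
      ‖Ring.inverse ((u : A) + e) - ↑u⁻¹‖ ≤ Q * Q * δ / (1 - δ * Q) := by
  obtain ⟨v, hv, h1, h2⟩ := unit_add_norm_inv_le u hQ he hδ
  refine ⟨hv ▸ v.isUnit, ?_, ?_⟩
  · rw [← hv, Ring.inverse_unit]; exact h1
  · rw [← hv, Ring.inverse_unit]; exact h2

end Ring

section Affine

variable {𝕜 : Type*} [NormedField 𝕜] {A : Type*} [NormedRing A] [NormOneClass A]
  [NormedAlgebra 𝕜 A] [CompleteSpace A]

/-- **Continuation disc for an affine family.**  `a x = a₀ - (x - x₀) • s`; a certified point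
`‖a₀⁻¹‖ ≤ Q` continues to every `x` with `‖x - x₀‖ ≤ ρ` provided `ρ ‖s‖ Q < 1`:
`a x` is invertible, `‖(a x)⁻¹‖ ≤ Q / (1 - ρ ‖s‖ Q)`, `‖(a x)⁻¹ - a₀⁻¹‖ ≤ Q Q ρ ‖s‖ / (1 - ρ ‖s‖ Q)`. -/
theorem affine_continuation (a₀ : Aˣ) (s : A) {x x₀ : 𝕜} {Q ρ : ℝ} (hQ : ‖(↑a₀⁻¹ : A)‖ ≤ Q)
    (hx : ‖x - x₀‖ ≤ ρ) (hρ : ρ * ‖s‖ * Q < 1) :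
    IsUnit ((a₀ : A) - (x - x₀) • s) ∧
      ‖Ring.inverse ((a₀ : A) - (x - x₀) • s)‖ ≤ Q / (1 - ρ * ‖s‖ * Q) ∧
      ‖Ring.inverse ((a₀ : A) - (x - x₀) • s) - ↑a₀⁻¹‖ ≤ Q * Q * (ρ * ‖s‖) / (1 - ρ * ‖s‖ * Q) := by
  have he : ‖(-((x - x₀) • s))‖ ≤ ρ * ‖s‖ := by
    rw [norm_neg, norm_smul]
    exact mul_le_mul_of_nonneg_right hx (norm_nonneg _)
  have h := isUnit_add_norm_inverse_le a₀ hQ he hρ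
  have heq : (a₀ : A) - (x - x₀) • s = (a₀ : A) + -((x - x₀) • s) := sub_eq_add_neg _ _
  rw [heq]
  exact h

/-- **Grid certificate.**  If every point of a set `S` lies in the continuation disc of some
certified grid point `i` (`‖a i⁻¹‖ ≤ Q i`, `‖x - x i‖ ‖s‖ Q i ≤ θ < 1`) and the family is affine
with the same slope `s` through every grid point (`a i = a₀ - (x i - x₀) • s`), then at every
`x ∈ S` the element `a₀ - (x - x₀) • s` is invertible with inverse norm `≤ Qmax / (1 - θ)`. -/
theorem grid_certificate {ι : Type*} (a₀ : A) (s : A) (x₀ : 𝕜) (xg : ι → 𝕜) (ag : ι → Aˣ)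
    (Q : ι → ℝ) {Qmax θ : ℝ} (hθ : θ < 1)
    (hfam : ∀ i, (ag i : A) = a₀ - (xg i - x₀) • s) (hQ : ∀ i, ‖(↑(ag i)⁻¹ : A)‖ ≤ Q i)
    (hQmax : ∀ i, Q i ≤ Qmax) {S : Set 𝕜}
    (hcover : ∀ x ∈ S, ∃ i, ‖x - xg i‖ * ‖s‖ * Q i ≤ θ) :
    ∀ x ∈ S, IsUnit (a₀ - (x - x₀) • s) ∧ ‖Ring.inverse (a₀ - (x - x₀) • s)‖ ≤ Qmax / (1 - θ) := by
  intro x hxS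
  obtain ⟨i, hi⟩ := hcover x hxS
  have hQi0 : 0 ≤ Q i := (norm_nonneg _).trans (hQ i)
  have hlt : ‖x - xg i‖ * ‖s‖ * Q i < 1 := lt_of_le_of_lt hi hθ
  have h := affine_continuation (ag i) s (x₀ := xg i) (hQ i) le_rfl hlt
  have heq : ((ag i : A) - (x - xg i) • s) = a₀ - (x - x₀) • s := by
    have hsc : (xg i - x₀) + (x - xg i) = x - x₀ := by abel
    rw [hfam i, sub_sub, ← add_smul, hsc]
  rw [heq] at h
  refine ⟨h.1, h.2.1.trans ?_⟩
  have hpos : 0 < 1 - θ := by linarith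
  have hden : 1 - θ ≤ 1 - ‖x - xg i‖ * ‖s‖ * Q i := by linarith
  calc Q i / (1 - ‖x - xg i‖ * ‖s‖ * Q i) ≤ Q i / (1 - θ) :=
        div_le_div_of_nonneg_left hQi0 hpos hden
    _ ≤ Qmax / (1 - θ) := div_le_div_of_nonneg_right (hQmax i) hpos.le

end Affine

end Summit.AnomalousDissipation.AnomalousDissipation.Theorems
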